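import Summits.ResolutionOfSingularities.ResolutionOfSingularities.Theorems.WeightedInvariantDatumToEmbeddedCentreHomogeneousCoaction
import Summits.ResolutionOfSingularities.ResolutionOfSingularities.Theorems.WeightedInvariantEssSmoothLocalHomOrder
import Summits.ResolutionOfSingularities.ResolutionOfSingularities.Theorems.WeightedInvariantIotaOrder
import Literature.AlgebraicGeometry.Resolution.AdicOrderBasics
import HarnessLib

/-!
# THE ORBIT LEMMA FOR THE ORDER LETTER: the order of a homogeneous element at a prime equals its order at the
# homogeneous core of that prime

Route `ResolutionOfSingularities/WeightedInvariant`, door crux `HypersurfaceCentreConstruction` (stmt-ResolutionOfSingularities-19897), P3 rung;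
the ORBIT-GENERIC reading convention of res-L1-w43-plan-1 RULING gen 11 #8 / #11 (letters at the closed points of a torus orbit are read at the
orbit-generic HOMOGENEOUS prime) made a theorem for the order letter `ν`, and the conicity step of (o57) R7-B `QuasiHomogeneousNoTie`
(Samuel strata of weighted-homogeneous forms are conical).  res-type-060 (gen 10), unordered in-lane helper (`--supports 19897 --as helper`,
counted 0).  [OURS · L1 W4.3]  AI proof, weaker than expert review; nothing here is a statement of the manuscript under review.

SETTING (the tree's graded encoding of torus actions, `Theorems/WeightedInvariantDatumToEmbeddedCentreHomogeneousCoaction.lean`): a ring `A` with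
a `ℤʲ`-grading `𝒜` and its coaction `ρ : A → A[ℤʲ]` (`exists_coaction`), `ι₀ : A → A[ℤʲ]` the inclusion `a ↦ a·[0]`.

* §1 `adicOrder_atPrime_eq_of_formallySmooth` — **the order is constant along smooth algebras**: for `A → B` formally smooth of finite type
  (`A` Noetherian), a prime `Q` of `B` over `P`, and `a ∈ A`: `ord_{B_Q}(a) = ord_{A_P}(a)` (res-type-039's
  `mem_pow_maximalIdeal_iff_of_formallySmooth_essFiniteType` at the local map `A_P → B_Q`, Mathlib `Localization.AtPrime.algebraOfLiesOver`,
  `FormallySmooth.localization_base`).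
* §2 the HOMOGENEOUS CORE of a prime `P` in coaction currency, `P♮ := (P·A[ℤʲ]).comap ρ`: `mem_comap_coaction_map_iff` (`a ∈ P♮ ↔` every
  component `a_χ ∈ P`), `comap_coaction_map_le` (`P♮ ≤ P`), `isPrime_comap_coaction_map`, `isHomogeneous_comap_coaction_map`,
  `comap_coaction_map_eq_self_of_isHomogeneous`, `mem_comap_coaction_map_of_mem` (homogeneous members of `P` lie in `P♮`).
* §3 **`adicOrder_atPrime_eq_adicOrder_atPrime_core`** — for HOMOGENEOUS `F` and any prime `P♮` equal to the core of `P`: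
  `ord_{A_P}(F) = ord_{A_{P♮}}(F)`; membership form `algebraMap_mem_pow_iff_of_core` and the door's `iotaOrd` form `iotaOrd_atPrime_eq_iotaOrd_atPrime_core`.
  PROOF (torus sweep): `Q₁ = P·A[ℤʲ]` lies over `P` and its pull-back `Q₂` along the shear automorphism `e` of `A[ℤʲ]` (`e ∘ ι₀ = ρ`,
  `exists_ringEquiv_comp_eq_coaction`) lies over `P♮`; `A → A[ℤʲ]` is smooth (`smooth_addMonoidAlgebra_pi`), so §1 moves the order from `A_P` to
  `A[ℤʲ]_{Q₁}` and from `A_{P♮}` to `A[ℤʲ]_{Q₂}`; `e` identifies `A[ℤʲ]_{Q₂} ≅ A[ℤʲ]_{Q₁}` carrying `ι₀ F` to `ρ F = (ι₀ F)·[d]`, a unit multiple.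
[cite: Matsumura1987, §22 Cor. to Thm. 22.5] [cite: Wlodarczyk2022, §2.3.1 (graded encoding of torus actions)]
-/

noncomputable section

set_option linter.dupNamespace false -- mandated namespace of this single-conjunct summit

open IsLocalRing Literature.AlgebraicGeometry.Resolution AddMonoidAlgebra DirectSum
open Summit.ResolutionOfSingularities.ResolutionOfSingularities.Cruxes.HypersurfaceCentreConstruction.LocalEngine

namespace Summit.ResolutionOfSingularities.ResolutionOfSingularities.Theorems

namespace OrbitOrder

/-! ## §1 The order is constant along smooth algebras -/

section Smooth

variable {A B : Type} [CommRing A] [CommRing B] [IsNoetherianRing A] [Algebra A B] [Algebra.FormallySmooth A B]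
  [Algebra.FiniteType A B]

/-- **The order is constant along smooth algebras**: for `A → B` formally smooth of finite type over a Noetherian `A`, a prime `Q` of `B`
lying over `P`, and `a ∈ A`, `ord_{B_Q}(a·1) = ord_{A_P}(a)` — the local map `A_P → B_Q` is flat with regular closed fibre.
[cite: Matsumura1987, §22 Cor. to Thm. 22.5] -/
theorem adicOrder_atPrime_eq_of_formallySmooth (P : Ideal A) [P.IsPrime] (Q : Ideal B) [Q.IsPrime] [Q.LiesOver P] (a : A) :
    adicOrder (algebraMap B (Localization.AtPrime Q) (algebraMap A B a)) = adicOrder (algebraMap A (Localization.AtPrime P) a) := by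
  letI := Localization.AtPrime.algebraOfLiesOver P Q
  haveI : IsNoetherianRing B := Algebra.FiniteType.isNoetherianRing A B
  haveI : IsNoetherianRing (Localization.AtPrime Q) := IsLocalization.isNoetherianRing Q.primeCompl _ inferInstance
  haveI : IsNoetherianRing (Localization.AtPrime P) := IsLocalization.isNoetherianRing P.primeCompl _ inferInstance
  haveI : IsLocalHom (algebraMap (Localization.AtPrime P) (Localization.AtPrime Q)) :=
    Localization.isLocalHom_localRingHom P Q (algebraMap A B) Ideal.LiesOver.over
  haveI : Algebra.FormallySmooth A (Localization.AtPrime Q) := inferInstance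
  haveI : Algebra.FormallySmooth (Localization.AtPrime P) (Localization.AtPrime Q) :=
    Algebra.FormallySmooth.localization_base P.primeCompl
  haveI : Algebra.EssFiniteType A (Localization.AtPrime Q) := inferInstance
  haveI : Algebra.EssFiniteType (Localization.AtPrime P) (Localization.AtPrime Q) :=
    Algebra.EssFiniteType.of_comp A _ _
  have hcomp : algebraMap (Localization.AtPrime P) (Localization.AtPrime Q) (algebraMap A _ a) =
      algebraMap B (Localization.AtPrime Q) (algebraMap A B a) := by
    rw [← IsScalarTower.algebraMap_apply, IsScalarTower.algebraMap_apply A B (Localization.AtPrime Q)]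
  have key := fun n => mem_pow_maximalIdeal_iff_of_formallySmooth_essFiniteType
    (S := Localization.AtPrime P) (S' := Localization.AtPrime Q) n (algebraMap A _ a)
  refine le_antisymm ?_ ?_
  · refine ENat.forall_natCast_le_iff_le.mp fun n hn => ?_
    rw [le_adicOrder_iff] at hn ⊢
    rw [← hcomp] at hn
    exact (key n).mpr hn
  · refine ENat.forall_natCast_le_iff_le.mp fun n hn => ?_
    rw [le_adicOrder_iff] at hn ⊢
    rw [← hcomp]
    exact (key n).mp hn

end Smooth

/-! ## §2 The homogeneous core of a prime, in coaction currency -/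

section Core

open DatumToEmbedded.CentreHomogeneous

variable {A : Type} [CommRing A] {σ : Type*} [SetLike σ A] [AddSubgroupClass σ A] {j : ℕ}
  (𝒜 : (Fin j → ℤ) → σ) [GradedRing 𝒜] (ρ : A →+* A[Fin j → ℤ])
  (hρ : ∀ (i : Fin j → ℤ) (a : A), a ∈ 𝒜 i → ρ a = single i a)

omit [GradedRing 𝒜] in
/-- `x ∈ P·A[ℤʲ]` iff every coefficient of `x` lies in `P`. [folklore] -/
theorem mem_map_singleZeroRingHom_iff {P : Ideal A} {x : A[Fin j → ℤ]} :
    x ∈ P.map (singleZeroRingHom : A →+* A[Fin j → ℤ]) ↔ ∀ m, x.coeff m ∈ P :=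
  ⟨fun h m => coeff_mem_of_mem_map h m, mem_map_of_coeff_mem⟩

omit [GradedRing 𝒜] in
/-- `P·A[ℤʲ]` contracts to `P` along `ι₀`. [folklore] -/
theorem comap_singleZeroRingHom_map (P : Ideal A) :
    (P.map (singleZeroRingHom : A →+* A[Fin j → ℤ])).comap singleZeroRingHom = P := by
  ext a
  rw [Ideal.mem_comap, mem_map_singleZeroRingHom_iff]
  constructor
  · intro h
    simpa [singleZeroRingHom_eq] using h 0
  · intro ha m
    rw [singleZeroRingHom_eq, coeff_single, Finsupp.single_apply]
    split_ifs
    · exact ha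
    · exact P.zero_mem

omit [GradedRing 𝒜] in
/-- `P·A[ℤʲ]` is prime for `P` prime: it is the kernel of `A[ℤʲ] → (A ⧸ P)[ℤʲ]`, and `(A ⧸ P)[ℤʲ]` is a domain. [folklore] -/
theorem isPrime_map_singleZeroRingHom (P : Ideal A) [P.IsPrime] :
    (P.map (singleZeroRingHom : A →+* A[Fin j → ℤ])).IsPrime := by
  have h : P.map (singleZeroRingHom : A →+* A[Fin j → ℤ]) =
      RingHom.ker (mapRingHom (Fin j → ℤ) (Ideal.Quotient.mk P)) := by
    ext x
    rw [mem_map_singleZeroRingHom_iff, RingHom.mem_ker]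
    constructor
    · intro hx
      ext m
      rw [coeff_mapRingHom, Ideal.Quotient.eq_zero_iff_mem.mpr (hx m)]
      rfl
    · intro hx m
      have := congrArg (fun y : (A ⧸ P)[Fin j → ℤ] => y.coeff m) hx
      simp only [coeff_mapRingHom] at this
      exact Ideal.Quotient.eq_zero_iff_mem.mp this
  rw [h]
  exact RingHom.ker_isPrime _

include hρ

/-- **The homogeneous core**: `a ∈ P♮ = (P·A[ℤʲ]).comap ρ` iff every homogeneous component of `a` lies in `P`. [folklore] -/
theorem mem_comap_coaction_map_iff (P : Ideal A) (a : A) :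
    a ∈ (P.map (singleZeroRingHom : A →+* A[Fin j → ℤ])).comap ρ ↔ ∀ i, (decompose 𝒜 a i : A) ∈ P := by
  rw [Ideal.mem_comap, mem_map_singleZeroRingHom_iff]
  simp only [coeff_coaction 𝒜 ρ hρ]

/-- `P♮ ≤ P`. [folklore] -/
theorem comap_coaction_map_le (P : Ideal A) : (P.map (singleZeroRingHom : A →+* A[Fin j → ℤ])).comap ρ ≤ P := by
  classical
  intro a ha
  rw [mem_comap_coaction_map_iff 𝒜 ρ hρ] at ha
  rw [← sum_support_decompose 𝒜 a]
  exact P.sum_mem fun i _ => ha i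

/-- Homogeneous members of `P` lie in `P♮`. [folklore] -/
theorem mem_comap_coaction_map_of_mem {P : Ideal A} {x : A} {d : Fin j → ℤ} (hx : x ∈ 𝒜 d) (hxP : x ∈ P) :
    x ∈ (P.map (singleZeroRingHom : A →+* A[Fin j → ℤ])).comap ρ := by
  classical
  rw [mem_comap_coaction_map_iff 𝒜 ρ hρ]
  intro i
  by_cases h : d = i
  · subst h
    rwa [decompose_of_mem_same 𝒜 hx]
  · rw [decompose_of_mem_ne 𝒜 hx h]
    exact P.zero_mem

/-- `P♮` is homogeneous. [folklore] -/
theorem isHomogeneous_comap_coaction_map (P : Ideal A) :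
    ((P.map (singleZeroRingHom : A →+* A[Fin j → ℤ])).comap ρ).IsHomogeneous 𝒜 := by
  intro i a ha
  rw [mem_comap_coaction_map_iff 𝒜 ρ hρ] at ha
  exact mem_comap_coaction_map_of_mem 𝒜 ρ hρ (decompose 𝒜 a i).2 (ha i)

/-- A homogeneous prime is its own core. [folklore] -/
theorem comap_coaction_map_eq_self_of_isHomogeneous {P : Ideal A} (hP : P.IsHomogeneous 𝒜) :
    (P.map (singleZeroRingHom : A →+* A[Fin j → ℤ])).comap ρ = P := by
  refine le_antisymm (comap_coaction_map_le 𝒜 ρ hρ P) fun a ha => ?_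
  rw [mem_comap_coaction_map_iff 𝒜 ρ hρ]
  exact fun i => hP i ha

omit hρ in
/-- `P♮` is prime for `P` prime. [folklore] -/
theorem isPrime_comap_coaction_map (P : Ideal A) [P.IsPrime] :
    ((P.map (singleZeroRingHom : A →+* A[Fin j → ℤ])).comap ρ).IsPrime := by
  haveI := isPrime_map_singleZeroRingHom (j := j) P
  exact Ideal.IsPrime.comap ρ

end Core

/-! ## §3 The orbit lemma -/

section Orbit

open DatumToEmbedded.CentreHomogeneous

variable {A : Type} [CommRing A] [IsNoetherianRing A] {σ : Type*} [SetLike σ A] [AddSubgroupClass σ A] {j : ℕ}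
  (𝒜 : (Fin j → ℤ) → σ) [GradedRing 𝒜] (ρ : A →+* A[Fin j → ℤ])
  (hρ : ∀ (i : Fin j → ℤ) (a : A), a ∈ 𝒜 i → ρ a = single i a)

omit [IsNoetherianRing A] [GradedRing 𝒜] in
/-- The monomial `[d]` is a unit of `A[ℤʲ]`. [folklore] -/
theorem isUnit_single_one (d : Fin j → ℤ) : IsUnit (single d (1 : A) : A[Fin j → ℤ]) :=
  ⟨⟨single d 1, single (-d) 1, by rw [single_mul_single, add_neg_cancel, mul_one, AddMonoidAlgebra.one_def],
    by rw [single_mul_single, neg_add_cancel, mul_one, AddMonoidAlgebra.one_def]⟩, rfl⟩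

include hρ

/-- **THE ORBIT LEMMA FOR THE ORDER**: for a HOMOGENEOUS `F ∈ 𝒜 d`, a prime `P`, and `P♮` the homogeneous core of `P`
(`P♮ = (P·A[ℤʲ]).comap ρ`), `ord_{A_P}(F) = ord_{A_{P♮}}(F)`.  Geometrically: the order of a torus-semi-invariant function is constant
along torus orbits, so it can be read at the orbit-generic (homogeneous) prime. [cite: Matsumura1987, §22 Cor. to Thm. 22.5] -/
theorem adicOrder_atPrime_eq_adicOrder_atPrime_core (P : Ideal A) [P.IsPrime] (Pc : Ideal A) [Pc.IsPrime]
    (hPc : Pc = (P.map (singleZeroRingHom : A →+* A[Fin j → ℤ])).comap ρ) {F : A} {d : Fin j → ℤ} (hF : F ∈ 𝒜 d) :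
    adicOrder (algebraMap A (Localization.AtPrime P) F) = adicOrder (algebraMap A (Localization.AtPrime Pc) F) := by
  classical
  haveI : Algebra.Smooth A A[Fin j → ℤ] := smooth_addMonoidAlgebra_pi A j
  haveI : Algebra.FormallySmooth A A[Fin j → ℤ] := inferInstance
  haveI : Algebra.FiniteType A A[Fin j → ℤ] := inferInstance
  have halg : ∀ a : A, algebraMap A A[Fin j → ℤ] a = singleZeroRingHom a := fun _ => rfl
  -- `Q₁ = P·A[ℤʲ]` lies over `P`
  let Q₁ : Ideal A[Fin j → ℤ] := P.map (singleZeroRingHom : A →+* A[Fin j → ℤ])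
  haveI hQ₁ : Q₁.IsPrime := isPrime_map_singleZeroRingHom P
  haveI : Q₁.LiesOver P := ⟨by
    rw [Ideal.under_def]
    conv_lhs => rw [← comap_singleZeroRingHom_map (j := j) P]
    exact Ideal.ext fun _ => Iff.rfl⟩
  have h1 := adicOrder_atPrime_eq_of_formallySmooth P Q₁ F
  -- the shear `e` and `Q₂ = e⁻¹ Q₁` over `P♮`
  obtain ⟨e, he⟩ := exists_ringEquiv_comp_eq_coaction 𝒜 ρ hρ
  let Q₂ : Ideal A[Fin j → ℤ] := Q₁.comap e
  haveI hQ₂ : Q₂.IsPrime := Ideal.IsPrime.comap e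
  have hQ₂c : Q₂.comap (singleZeroRingHom : A →+* A[Fin j → ℤ]) = Pc := by
    rw [hPc, ← he]
    exact Ideal.ext fun _ => Iff.rfl
  haveI : Q₂.LiesOver Pc := ⟨by rw [Ideal.under_def, ← hQ₂c]; exact Ideal.ext fun _ => Iff.rfl⟩
  have h2 := adicOrder_atPrime_eq_of_formallySmooth Pc Q₂ F
  -- transport along `e : A[ℤʲ]_{Q₂} ≅ A[ℤʲ]_{Q₁}`
  let ε := Localization.localRingEquiv Q₂ Q₁ e rfl
  have h3 : adicOrder (algebraMap A[Fin j → ℤ] (Localization.AtPrime Q₂) (singleZeroRingHom F)) =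
      adicOrder (algebraMap A[Fin j → ℤ] (Localization.AtPrime Q₁) (e (singleZeroRingHom F))) := by
    rw [← adicOrder_map_ringEquiv ε (algebraMap _ (Localization.AtPrime Q₂) (singleZeroRingHom F))]
    congr 1
    exact Localization.localRingHom_to_map Q₂ Q₁ (e : A[Fin j → ℤ] →+* A[Fin j → ℤ]) rfl (singleZeroRingHom F)
  -- `e (ι₀ F) = ρ F = ι₀ F · [d]`
  have h4 : e (singleZeroRingHom F) = singleZeroRingHom F * single d 1 := by
    have := congrArg (fun φ : A →+* A[Fin j → ℤ] => φ F) he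
    simp only [RingHom.coe_comp, Function.comp_apply, RingEquiv.toRingHom_eq_coe, RingHom.coe_coe] at this
    rw [this, hρ d F hF, singleZeroRingHom_eq, single_mul_single, zero_add, mul_one]
  have h5 : adicOrder (algebraMap A[Fin j → ℤ] (Localization.AtPrime Q₁) (e (singleZeroRingHom F))) =
      adicOrder (algebraMap A[Fin j → ℤ] (Localization.AtPrime Q₁) (singleZeroRingHom F)) := by
    rw [h4, map_mul]
    exact adicOrder_mul_of_isUnit_right _ ((isUnit_single_one d).map _)
  rw [halg] at h1 h2
  rw [← h1, ← h2, h3, h5]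

/-- Membership form: `F ∈ Pⁿ A_P ↔ F ∈ P♮ⁿ A_{P♮}` for homogeneous `F`. [folklore] -/
theorem algebraMap_mem_pow_iff_of_core (P : Ideal A) [P.IsPrime] (Pc : Ideal A) [Pc.IsPrime]
    (hPc : Pc = (P.map (singleZeroRingHom : A →+* A[Fin j → ℤ])).comap ρ) {F : A} {d : Fin j → ℤ} (hF : F ∈ 𝒜 d) (n : ℕ) :
    algebraMap A (Localization.AtPrime P) F ∈ maximalIdeal (Localization.AtPrime P) ^ n ↔
      algebraMap A (Localization.AtPrime Pc) F ∈ maximalIdeal (Localization.AtPrime Pc) ^ n := by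
  rw [← le_adicOrder_iff, ← le_adicOrder_iff, adicOrder_atPrime_eq_adicOrder_atPrime_core 𝒜 ρ hρ P Pc hPc hF]

/-- **The door's `ν`-letter form**: `iotaOrd (A_P) F = iotaOrd (A_{P♮}) F` for homogeneous `F` — the order letter of a `T`-homogeneous
element at any prime of the cobordant algebra is its letter at the orbit-generic homogeneous prime (RULING gen 11 #8's reading, for `ν`).
[OURS · L1 W4.3] -/
theorem iotaOrd_atPrime_eq_iotaOrd_atPrime_core (P : Ideal A) [P.IsPrime] (Pc : Ideal A) [Pc.IsPrime]
    (hPc : Pc = (P.map (singleZeroRingHom : A →+* A[Fin j → ℤ])).comap ρ) {F : A} {d : Fin j → ℤ} (hF : F ∈ 𝒜 d) :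
    iotaOrd (Localization.AtPrime P) (algebraMap A _ F) = iotaOrd (Localization.AtPrime Pc) (algebraMap A _ F) := by
  rw [iotaOrd_eq_ordOfENat_adicOrder, iotaOrd_eq_ordOfENat_adicOrder,
    adicOrder_atPrime_eq_adicOrder_atPrime_core 𝒜 ρ hρ P Pc hPc hF]

end Orbit

end OrbitOrder

end Summit.ResolutionOfSingularities.ResolutionOfSingularities.Theorems
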